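import Mathlib.NumberTheory.NumberField.Completion.Ramification
import Mathlib.RingTheory.Complex
import Mathlib.RingTheory.Norm.Transitivity
import Literature.NumberTheory.AdelicBaseChange.IdeleConormIdeals
import Literature.NumberTheory.AdelicBaseChange.AdeleNormArchimedean
import Literature.NumberTheory.AdelicBaseChange.AdeleNormGalois
import HarnessLib

/-!
# The idèle module under norm and conorm: `‖N_{L/K} 𝐀‖_K = ‖𝐀‖_L` and `‖con_{L/K} 𝐚‖_L = ‖𝐚‖_K^{[L:K]}`

[cite: CasselsFrohlichANT1967, Ch. II §11 (Lemma: «‖α‖ = |Norm_{K/k} α|»; «‖b‖ = |b|^N»; Theorem: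
«∏_j ‖α‖_j = |Norm_{K/k} α|»), §12 (proof of the product formula: «∏_v |α|_v = ∏_V (∏_{v∣V} |α|_v) = ∏_V |Norm_{k/Q} α|_V»),
§16 (the idèle module `|α| = ∏_v |α_v|_v`), §19 (19.19) («N_{K/k} 𝐀 = {∏_{V∣v} N_{K_V/k_v} A_V}_v»)]
[cite: WeilBNT1967, Ch. IV §3, Corollary of Proposition 3 («the module of x ↦ ax on 𝒜_A is |N_{𝒜/k}(a)|_A»),
with Ch. IV §1, Theorem 1 and Corollary 3 (`(k'/k)_A = k'_A`, `z_v = ∏_{w∣v} N_{k'_w/k_v}(x'_w)`)]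

Let `L/K` be an extension of number fields, `n = [L:K]`.  The tree's **idèle module** (content, idelic norm) is
`Literature.NumberTheory.Automorphic.IdeleClassGroup.ideleNorm K : J_K →* ℝ≥0`,
`‖𝐚‖_K = ∏_{v∣∞} ‖a_v‖^{mult v} · ∏_{v∤∞} ‖a_v‖_v` — Cassels's normalised valuations of Ch. II §11 (`mult v = 2` at a
complex place: «the square of the absolute value»; `‖ϖ_v‖_v = N(v)⁻¹` at a finite place).  This file proves, sorry-free
and without named facts, the two compatibilities of the module with the packet's maps of `…AdeleNormTrace` (FILE
`IdeleNormIdeals`/`IdeleConormIdeals` of this folder):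

* §1 **the archimedean local statement** (Cassels's §11 Lemma at `v ∣ ∞`): for `w ∣ v` infinite places,
  `‖N_{L_w/K_v} z‖ = ‖z‖^{[L_w:K_v]}` (`norm_algebraNorm_completion_eq_pow`) and, in normalised form,
  `‖N_{L_w/K_v} z‖^{mult v} = ‖z‖^{mult w}` (`norm_algebraNorm_completion_pow_mult`), with `mult w = mult v · [L_w:K_v]`
  and `∑_{w∣v} mult w = mult v · n`;
* §2 **the finite part through ideals** (Cassels §17 with (19.22)): `∏_{v∤∞} ‖x_v‖_v = 𝔑((x))⁻¹` for a finite idèle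
  `x`, `(x) = ∏ v^{ord_v x}` its ideal (`finprod_norm_apply_eq_inv_absNorm`); hence
  `∏_v ‖(N x)_v‖_v = ∏_w ‖x_w‖_w` (`finprod_norm_finiteIdeleRelNorm`, from `(N x) = N_{L|K}((x))` and
  `𝔑(N_{L|K} 𝔄) = 𝔑(𝔄)`) and `∏_w ‖(con x)_w‖_w = (∏_v ‖x_v‖_v)^n` (`finprod_norm_finiteIdeleConorm`);
* §3 **THE MODULE OF A NORM: `‖N_{L/K} 𝐀‖_K = ‖𝐀‖_L`** for every idèle `𝐀 ∈ J_L` (`ideleNorm_ideleRelNorm`) — Weil's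
  Corollary of Prop. IV.3 for `𝒜 = L` over `k = K`, Cassels's §11 Theorem place by place and (19.19);
* §4 **THE MODULE OF A CONORM: `‖con_{L/K} 𝐚‖_L = ‖𝐚‖_K^n`** for `𝐚 ∈ J_K` (`ideleNorm_ideleBaseChange`, for the tree's
  `Automorphic.AdeleRing.ideleBaseChange`, = the packet's `NumberField.AdeleRing.baseChange` on units by
  `…AutomorphicCompat`) — Cassels's «‖b‖ = |b|^N» place by place;
* §5 consequences: norm-one idèles go to norm-one idèles (both directions for `con`), the statements on idèle CLASSES
  (`IdeleClassGroup.norm`), the versions for the Galois-descent norm `Automorphic.AdeleRing.ideleRelNorm` (`L/K` Galois,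
  via `…AdeleNormGalois.automorphic_ideleRelNorm_eq`) and for the real-valued `GaloisRepresentations.ideleNorm`.

Deviation from the print: Cassels proves the §11 Lemma at ALL places by Haar measure; here the archimedean places are
done by the explicit trichotomy `ℝ/ℝ`, `ℂ/ℝ`, `ℂ/ℂ` (Mathlib's `Completion.Ramification` isometries), and the finite
places globally through the ideal norm (`…IdeleNormIdeals.toFractionalIdeal_finiteIdeleRelNorm`,
`…FractionalIdealRelNorm.absNorm_fracIdealRelNorm`), which is Cassels's own route «from the Lemma of §11 and (19.17) …
(19.22) N_{K/k} V = f_V v».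

## References
* [CasselsFrohlichANT1967] J. W. S. Cassels, *Global fields*, Ch. II of Cassels–Fröhlich (eds.), *Algebraic Number Theory*
  (1967), §11 (Lemma, Theorem), §12, §16, §17, §19 (19.19), (19.22).
* [WeilBNT1967] A. Weil, *Basic Number Theory* (1967), Ch. IV §1 (Th. 1, Cor. 3), §3 (Prop. 3 and its Corollary).

## Provenance
Lane `hodge-director` Track 2f (`flt-inv`), seat `literature-prover-hodge-director-flt-inv-g26-0` (FILE D of gen 26).
-/

set_option autoImplicit false

noncomputable section

open scoped nonZeroDivisors NumberField NumberField.AdeleRing NumberField.LiesOver NNReal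

namespace Literature.NumberTheory.AdelicBaseChange

open NumberField IsDedekindDomain Module
open Literature.NumberTheory.NumberFields
open Literature.NumberTheory.GaloisRepresentations (ideleGroup)

/-! ## §1 The §11 Lemma at the archimedean places: `‖N_{L_w/K_v} z‖^{mult v} = ‖z‖^{mult w}` -/

section Archimedean

open NumberField.InfinitePlace NumberField.InfinitePlace.Completion NumberField.ComplexEmbedding

variable {K L : Type} [Field K] [Field L] [Algebra K L]

/-- **`‖N_{L_w/K_v} z‖ = ‖z‖^{[L_w : K_v]}`** at infinite places `w ∣ v` (Mathlib's `‖·‖` on `w.Completion` is the ordinary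
absolute value; the three cases `L_w/K_v = ℝ/ℝ, ℂ/ℝ, ℂ/ℂ` through the isometries `Completion.isometry_extensionEmbedding(·OfIsReal)`
and `Algebra.norm_eq_of_equiv_equiv`, as in Mathlib's `Completion.Ramification`; for `ℂ/ℝ`, `N z = z z̄ = |z|²`,
`Algebra.norm_complex_apply`). [cite: CasselsFrohlichANT1967, Ch. II §11 Lemma («‖α‖ = |Norm_{K/k} α|», case (2))] -/
theorem norm_algebraNorm_completion_eq_pow (v : InfinitePlace K) (w : InfinitePlace L) [w.1.LiesOver v.1]
    (z : w.Completion) :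
    ‖Algebra.norm v.Completion z‖ = ‖z‖ ^ Module.finrank v.Completion w.Completion := by
  rcases v.isReal_or_isComplex with hv | hv
  · -- `v` real: `K_v ≅ ℝ`
    have := LiesOver.extensionEmbedding_liesOver_of_isReal w hv
    have h1 : ∀ r : ℝ, ‖(ringEquivRealOfIsReal hv).symm r‖ = ‖r‖ := fun r => by
      conv_rhs => rw [← (ringEquivRealOfIsReal hv).apply_symm_apply r]
      exact ((AddMonoidHomClass.isometry_iff_norm _).1 (isometry_extensionEmbeddingOfIsReal hv) _).symm
    rcases w.isReal_or_isComplex with hw | hw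
    · -- `w` real: `L_w ≅ ℝ`, `N = id`
      have he : (algebraMap ℝ ℝ).comp (ringEquivRealOfIsReal hv : v.Completion →+* ℝ) =
          (ringEquivRealOfIsReal hw : w.Completion →+* ℝ).comp (algebraMap v.Completion w.Completion) :=
        RingHom.ext fun _ ↦ Complex.ofReal_inj.1 <| by simp
      rw [Algebra.norm_eq_of_equiv_equiv (ringEquivRealOfIsReal hv) (ringEquivRealOfIsReal hw) he,
        Algebra.finrank_eq_of_equiv_equiv (ringEquivRealOfIsReal hv) (ringEquivRealOfIsReal hw) he,
        Module.finrank_self, pow_one, Algebra.norm_self, MonoidHom.id_apply, h1]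
      exact (AddMonoidHomClass.isometry_iff_norm _).1 (isometry_extensionEmbeddingOfIsReal hw) z
    · -- `w` complex: `L_w ≅ ℂ`, `N z = z z̄`
      have he : (algebraMap ℝ ℂ).comp (ringEquivRealOfIsReal hv : v.Completion →+* ℝ) =
          (ringEquivComplexOfIsComplex hw : w.Completion →+* ℂ).comp (algebraMap v.Completion w.Completion) := by
        ext; simp
      rw [Algebra.norm_eq_of_equiv_equiv (ringEquivRealOfIsReal hv) (ringEquivComplexOfIsComplex hw) he,
        Algebra.finrank_eq_of_equiv_equiv (ringEquivRealOfIsReal hv) (ringEquivComplexOfIsComplex hw) he,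
        Complex.finrank_real_complex, Algebra.norm_complex_apply, h1, Complex.normSq_eq_norm_sq,
        Real.norm_of_nonneg (sq_nonneg _)]
      congr 1
      exact (AddMonoidHomClass.isometry_iff_norm _).1 (isometry_extensionEmbedding w) z
  · -- `v` complex: `w` complex, `K_v ≅ L_w ≅ ℂ`, `N = id`
    have hw : w.IsComplex := LiesOver.isComplex_of_isComplex_under w hv
    have h1 : ∀ r : ℂ, ‖(ringEquivComplexOfIsComplex hv).symm r‖ = ‖r‖ := fun r => by
      conv_rhs => rw [← (ringEquivComplexOfIsComplex hv).apply_symm_apply r]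
      exact ((AddMonoidHomClass.isometry_iff_norm _).1 (isometry_extensionEmbedding v) _).symm
    cases LiesOver.embedding_comp_eq_or_conjugate_embedding_comp_eq w v with
    | inl hl =>
      have : ComplexEmbedding.LiesOver w.embedding v.embedding := ⟨hl⟩
      have := liesOver_extensionEmbedding w v
      have he : (algebraMap ℂ ℂ).comp (ringEquivComplexOfIsComplex hv : v.Completion →+* ℂ) =
          (ringEquivComplexOfIsComplex hw : w.Completion →+* ℂ).comp (algebraMap v.Completion w.Completion) := by
        ext; simp
      rw [Algebra.norm_eq_of_equiv_equiv (ringEquivComplexOfIsComplex hv) (ringEquivComplexOfIsComplex hw) he,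
        Algebra.finrank_eq_of_equiv_equiv (ringEquivComplexOfIsComplex hv) (ringEquivComplexOfIsComplex hw) he,
        Module.finrank_self, pow_one, Algebra.norm_self, MonoidHom.id_apply, h1]
      exact (AddMonoidHomClass.isometry_iff_norm _).1 (isometry_extensionEmbedding w) z
    | inr hr =>
      have : ComplexEmbedding.LiesOver (conjugate w.embedding) v.embedding := ⟨hr⟩
      have := liesOver_conjugate_extensionEmbedding w v
      have he : (algebraMap ℂ ℂ).comp (ringEquivComplexOfIsComplex hv : v.Completion →+* ℂ) =
          (((ringEquivComplexOfIsComplex hw).trans (starRingAut (R := ℂ))) : w.Completion →+* ℂ).comp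
            (algebraMap v.Completion w.Completion) := by
        ext; simp [← conjugate_coe_eq]
      rw [Algebra.norm_eq_of_equiv_equiv (ringEquivComplexOfIsComplex hv)
          ((ringEquivComplexOfIsComplex hw).trans (starRingAut (R := ℂ))) he,
        Algebra.finrank_eq_of_equiv_equiv (ringEquivComplexOfIsComplex hv)
          ((ringEquivComplexOfIsComplex hw).trans (starRingAut (R := ℂ))) he,
        Module.finrank_self, pow_one, Algebra.norm_self, MonoidHom.id_apply, h1, RingEquiv.coe_trans,
        Function.comp_apply]
      change ‖starRingEnd ℂ (ringEquivComplexOfIsComplex hw z)‖ = _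
      rw [Complex.norm_conj]
      exact (AddMonoidHomClass.isometry_iff_norm _).1 (isometry_extensionEmbedding w) z

/-- **`mult w = mult v · [L_w : K_v]`** for `w ∣ v` (`mult = 1` at real, `2` at complex places; `[L_w:K_v] = 1` if `w/v` is
unramified, `2` if ramified — Mathlib `finrank_eq_one_of_isUnramified`, `finrank_eq_two_of_isRamified`): Cassels's
normalisation exponents in a tower. [cite: CasselsFrohlichANT1967, Ch. II §11 (normalized valuations, cases (2(i)), (2(ii)))] -/
theorem mult_eq_mult_mul_finrank (v : InfinitePlace K) (w : InfinitePlace L) [w.1.LiesOver v.1] :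
    w.mult = v.mult * Module.finrank v.Completion w.Completion := by
  have hcomap : w.comap (algebraMap K L) = v := LiesOver.comap_eq w v
  rcases v.isReal_or_isComplex with hv | hv
  · rcases w.isReal_or_isComplex with hw | hw
    · have hun : w.IsUnramified K := by
        rw [isUnramified_iff_mult_le, hcomap]; simp [mult, hv, hw]
      rw [finrank_eq_one_of_isUnramified v hun]; simp [mult, hv, hw]
    · have hram : w.IsRamified K := by
        rw [IsRamified, isUnramified_iff_mult_le, hcomap]; simp [mult, hv, not_isReal_iff_isComplex.2 hw]
      rw [finrank_eq_two_of_isRamified v hram]; simp [mult, hv, not_isReal_iff_isComplex.2 hw]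
  · have hw : w.IsComplex := LiesOver.isComplex_of_isComplex_under w hv
    have hun : w.IsUnramified K := by
      rw [isUnramified_iff_mult_le, hcomap]; simp [mult, not_isReal_iff_isComplex.2 hv, not_isReal_iff_isComplex.2 hw]
    rw [finrank_eq_one_of_isUnramified v hun]
    simp [mult, not_isReal_iff_isComplex.2 hv, not_isReal_iff_isComplex.2 hw]

/-- **Cassels's §11 Lemma at an archimedean place, normalised form: `‖N_{L_w/K_v} z‖^{mult v} = ‖z‖^{mult w}`** — the
normalised valuation of `L_w` («the square of the absolute value» at complex `w`) is the normalised valuation of `K_v`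
composed with `Norm_{L_w/K_v}`. [cite: CasselsFrohlichANT1967, Ch. II §11 Lemma («‖α‖ = |Norm_{K/k} α|»)] -/
theorem norm_algebraNorm_completion_pow_mult (v : InfinitePlace K) (w : InfinitePlace L) [w.1.LiesOver v.1]
    (z : w.Completion) :
    ‖Algebra.norm v.Completion z‖ ^ v.mult = ‖z‖ ^ w.mult := by
  rw [norm_algebraNorm_completion_eq_pow, ← pow_mul, mul_comm, ← mult_eq_mult_mul_finrank v w]

/-- **«‖b‖ = |b|^N» at an archimedean place**: `‖ι_w y‖^{mult w} = (‖y‖^{mult v})^{[L_w:K_v]}` for `y ∈ K_v`, `ι_w : K_v → L_w`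
(Mathlib's `LiesOver.completionMap`, an isometry). [cite: CasselsFrohlichANT1967, Ch. II §11 (proof of the Lemma: «‖b‖ = |b|^N»)] -/
theorem norm_algebraMap_completion_pow_mult (v : InfinitePlace K) (w : InfinitePlace L) [w.1.LiesOver v.1]
    (y : v.Completion) :
    ‖algebraMap v.Completion w.Completion y‖ ^ w.mult = (‖y‖ ^ v.mult) ^ Module.finrank v.Completion w.Completion := by
  rw [RingHom.algebraMap_toAlgebra, Literature.NumberTheory.Automorphic.norm_completionMap K L v w y, ← pow_mul,
    mult_eq_mult_mul_finrank v w]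

variable (L) in
open scoped Classical in
/-- **`∑_{w∣v} mult w = mult v · [L:K]`** for `v ∣ ∞` (`∑_{w∣v} [L_w:K_v] = [L:K]`, the packet's
`Completion.finrank_prod_eq_finrank`, i.e. (19.14) `K_v ⊗_K L = ⊕_{w∣v} L_w`). [cite: CasselsFrohlichANT1967, Ch. II §19 (19.14) with §11] -/
theorem sum_mult_extension [NumberField K] [NumberField L] (v : InfinitePlace K) :
    ∑ w : v.Extension L, w.1.mult = v.mult * Module.finrank K L := by
  rw [← NumberField.InfinitePlace.Completion.finrank_prod_eq_finrank L v, Module.finrank_pi_fintype, Finset.mul_sum]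
  exact Finset.sum_congr rfl fun w _ => mult_eq_mult_mul_finrank v w.1

end Archimedean

/-! ## §2 The finite part of the module through ideals: `∏_{v∤∞} ‖x_v‖_v = 𝔑((x))⁻¹` -/

section Finite

open IsDedekindDomain.HeightOneSpectrum
open Literature.NumberTheory.NumberFields.IdeleIdeal (toIdealUnits coe_toIdealUnits)
open Literature.NumberTheory.Automorphic.FiniteAdeleRing (unitOrd toFractionalIdeal valued_apply_eq_exp_neg_unitOrd
  unitOrd_eventually_eq_zero)

variable (K L : Type) [Field K] [NumberField K] [Field L] [NumberField L] [Algebra K L]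

variable {K} in
/-- **`‖x_v‖_v = N(v)^{-ord_v x}`** for a finite idèle `x` (Mathlib's normalised `‖·‖` on `K_v`, `FinitePlace.norm_def`, and the
tree's `ord_v`, `valued_apply_eq_exp_neg_unitOrd`). [cite: CasselsFrohlichANT1967, Ch. II §7 and §11 (1) (normalized non-arch. valuation: `|π| = (N v)⁻¹`), §17 (`ord_v`)] -/
theorem norm_apply_eq_absNorm_zpow_neg_unitOrd (x : (FiniteAdeleRing (𝓞 K) K)ˣ) (v : HeightOneSpectrum (𝓞 K)) :
    ‖(x : FiniteAdeleRing (𝓞 K) K) v‖ = ((Ideal.absNorm v.asIdeal : ℕ) : ℝ) ^ (-unitOrd (𝓞 K) K x v) := by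
  rw [FinitePlace.norm_def, valued_apply_eq_exp_neg_unitOrd, WithZero.exp,
    WithZeroMulInt.toNNReal_neg_apply _ WithZero.coe_ne_zero, WithZero.unzero_coe, toAdd_ofAdd, NNReal.coe_zpow,
    NNReal.coe_natCast]

variable {K} in
/-- **`𝔑((x)) = ∏_v N(v)^{ord_v x}`**: the absolute norm (Mathlib `FractionalIdeal.absNorm`, in `ℚ`) of the ideal
`(x) = ∏_v v^{ord_v x}` of a finite idèle. [cite: CasselsFrohlichANT1967, Ch. II §17 («α ↦ ∑ (ord_v α)·v», J_k → I_k)] -/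
theorem absNorm_toFractionalIdeal (x : (FiniteAdeleRing (𝓞 K) K)ˣ) :
    FractionalIdeal.absNorm (toFractionalIdeal (𝓞 K) K x) =
      ∏ᶠ v : HeightOneSpectrum (𝓞 K), ((Ideal.absNorm v.asIdeal : ℕ) : ℚ) ^ unitOrd (𝓞 K) K x v := by
  have hsupp : (fun v : HeightOneSpectrum (𝓞 K) =>
      (v.asIdeal : FractionalIdeal (𝓞 K)⁰ K) ^ unitOrd (𝓞 K) K x v).HasFiniteMulSupport := by
    refine Set.Finite.subset (Filter.eventually_cofinite.mp (unitOrd_eventually_eq_zero x)) fun v hv => ?_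
    intro h0
    exact hv (by simp only [h0, zpow_zero])
  rw [toFractionalIdeal, map_finprod _ hsupp]
  exact finprod_congr fun v => by rw [map_zpow₀, FractionalIdeal.coeIdeal_absNorm]

variable {K} in
/-- **The finite part of the idèle module is `𝔑((x))⁻¹`: `∏_{v∤∞} ‖x_v‖_v = 𝔑(∏_v v^{ord_v x})⁻¹`** (each factor is
`N(v)^{-ord_v x}`). [cite: CasselsFrohlichANT1967, Ch. II §16 (the idèle module), §17] -/
theorem finprod_norm_apply_eq_inv_absNorm (x : (FiniteAdeleRing (𝓞 K) K)ˣ) :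
    ∏ᶠ v : HeightOneSpectrum (𝓞 K), ‖(x : FiniteAdeleRing (𝓞 K) K) v‖ =
      (((FractionalIdeal.absNorm (toFractionalIdeal (𝓞 K) K x) : ℚ) : ℝ))⁻¹ := by
  have hsupp : (fun v : HeightOneSpectrum (𝓞 K) =>
      ((Ideal.absNorm v.asIdeal : ℕ) : ℚ) ^ unitOrd (𝓞 K) K x v).HasFiniteMulSupport := by
    refine Set.Finite.subset (Filter.eventually_cofinite.mp (unitOrd_eventually_eq_zero x)) fun v hv => ?_
    intro h0
    exact hv (by simp only [h0, zpow_zero])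
  rw [absNorm_toFractionalIdeal, ← Rat.coe_castHom, map_finprod (Rat.castHom ℝ) hsupp, ← finprod_inv_distrib]
  refine finprod_congr fun v => ?_
  rw [norm_apply_eq_absNorm_zpow_neg_unitOrd, zpow_neg, Rat.coe_castHom, Rat.cast_zpow, Rat.cast_natCast]

variable {K} in
/-- `(x^n) = (x)^n` for the ideal of a finite idèle (the tree's `toIdealUnits` is a homomorphism).
[cite: CasselsFrohlichANT1967, Ch. II §17 (J_k → I_k is a homomorphism)] -/
theorem toFractionalIdeal_pow (x : (FiniteAdeleRing (𝓞 K) K)ˣ) (n : ℕ) :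
    toFractionalIdeal (𝓞 K) K (x ^ n) = toFractionalIdeal (𝓞 K) K x ^ n := by
  rw [← coe_toIdealUnits, map_pow, Units.val_pow_eq_pow_val, coe_toIdealUnits]

/-- **The finite part of `‖N_{L/K} x‖_K` is that of `‖x‖_L`: `∏_v ‖(N x)_v‖_v = ∏_w ‖x_w‖_w`** for a finite idèle `x ∈ J_{L,f}`
— because `(N x) = N_{L|K}((x))` (`toFractionalIdeal_finiteIdeleRelNorm`) and `𝔑(N_{L|K} 𝔄) = 𝔑(𝔄)`
(`absNorm_fracIdealRelNorm`); Cassels's §11 Theorem at the finite places via (19.22) `N_{K/k} V = f_V v`.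
[cite: CasselsFrohlichANT1967, Ch. II §11 Theorem («∏_j ‖α‖_j = |Norm_{K/k} α|»), §19 (19.22)] -/
theorem finprod_norm_finiteIdeleRelNorm (x : (FiniteAdeleRing (𝓞 L) L)ˣ) :
    ∏ᶠ v : HeightOneSpectrum (𝓞 K), ‖(finiteIdeleRelNorm K L x : FiniteAdeleRing (𝓞 K) K) v‖ =
      ∏ᶠ w : HeightOneSpectrum (𝓞 L), ‖(x : FiniteAdeleRing (𝓞 L) L) w‖ := by
  rw [finprod_norm_apply_eq_inv_absNorm, finprod_norm_apply_eq_inv_absNorm, toFractionalIdeal_finiteIdeleRelNorm,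
    absNorm_fracIdealRelNorm]

/-- **The finite part of `‖con_{L/K} x‖_L` is that of `‖x‖_K^n`: `∏_w ‖(con x)_w‖_w = (∏_v ‖x_v‖_v)^{[L:K]}`** for
`x ∈ J_{K,f}` — from `N(con x) = x^n` ((19.11), `finiteIdeleRelNorm_finiteIdeleConorm`) and the previous statement.
[cite: CasselsFrohlichANT1967, Ch. II §11 («‖b‖ = |b|^N»), §19 (19.11)] -/
theorem finprod_norm_finiteIdeleConorm (x : (FiniteAdeleRing (𝓞 K) K)ˣ) :
    ∏ᶠ w : HeightOneSpectrum (𝓞 L), ‖(finiteIdeleConorm K L x : FiniteAdeleRing (𝓞 L) L) w‖ =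
      (∏ᶠ v : HeightOneSpectrum (𝓞 K), ‖(x : FiniteAdeleRing (𝓞 K) K) v‖) ^ finrank K L := by
  rw [finprod_norm_apply_eq_inv_absNorm, finprod_norm_apply_eq_inv_absNorm,
    ← absNorm_fracIdealRelNorm (𝓞 K) K (toFractionalIdeal (𝓞 L) L _), ← toFractionalIdeal_finiteIdeleRelNorm,
    finiteIdeleRelNorm_finiteIdeleConorm, toFractionalIdeal_pow, map_pow, Rat.cast_pow, inv_pow]

/-- The finite components of `N_{L/K} 𝐀` are those of `N(𝐀_𝐡)` (`finitePart_ideleRelNorm`, on values).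
[cite: CasselsFrohlichANT1967, Ch. II §19 (19.7) with §16] -/
theorem coe_ideleRelNorm_snd (y : ideleGroup L) :
    ((ideleRelNorm K L y : ideleGroup K) : AdeleRing (𝓞 K) K).2 =
      (finiteIdeleRelNorm K L (IdeleAction.finitePart L y) : FiniteAdeleRing (𝓞 K) K) := by
  rw [← finitePart_ideleRelNorm]; rfl

/-- The finite components of `con_{L/K} 𝐚` (the tree's `ideleBaseChange`) are those of `con(𝐚_𝐡)`.
[cite: CasselsFrohlichANT1967, Ch. II §19 (19.2) with §16] -/
theorem coe_ideleBaseChange_snd (x : ideleGroup K) :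
    ((Literature.NumberTheory.Automorphic.AdeleRing.ideleBaseChange K L x : ideleGroup L) : AdeleRing (𝓞 L) L).2 =
      (finiteIdeleConorm K L (IdeleAction.finitePart K x) : FiniteAdeleRing (𝓞 L) L) := by
  rw [coe_ideleBaseChange_eq_baseChange]; rfl

end Finite

/-! ## §3 `‖N_{L/K} 𝐀‖_K = ‖𝐀‖_L` -/

section Module

open NumberField.InfinitePlace
open Literature.NumberTheory.Automorphic (coe_ideleNorm mem_normOneIdeles normOneIdeles)

variable (K L : Type) [Field K] [NumberField K] [Field L] [NumberField L] [Algebra K L]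

/-- **The archimedean part: `∏_v ‖(N 𝐀)_v‖^{mult v} = ∏_w ‖A_w‖^{mult w}`** — `(N 𝐀)_v = ∏_{w∣v} N_{L_w/K_v} A_w` ((19.19),
`adeleRelNorm_fst_apply_eq_prod`) and §1 at each `w ∣ v`, the product over `w` regrouped along `w ↦ w|_K`.
[cite: CasselsFrohlichANT1967, Ch. II §11 Theorem, §19 (19.19)] [cite: WeilBNT1967, Ch. IV §1, Corollary 3] -/
theorem prod_norm_ideleRelNorm_fst_pow_mult (y : ideleGroup L) :
    ∏ v : InfinitePlace K, ‖((ideleRelNorm K L y : ideleGroup K) : AdeleRing (𝓞 K) K).1 v‖ ^ v.mult =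
      ∏ w : InfinitePlace L, ‖(y : AdeleRing (𝓞 L) L).1 w‖ ^ w.mult := by
  classical
  rw [← Fintype.prod_fiberwise (fun w : InfinitePlace L => w.comap (algebraMap K L))
    (fun w : InfinitePlace L => ‖(y : AdeleRing (𝓞 L) L).1 w‖ ^ w.mult)]
  refine Finset.prod_congr rfl fun v _ => ?_
  rw [coe_ideleRelNorm, adeleRelNorm_fst_apply_eq_prod, norm_prod, ← Finset.prod_pow]
  exact Finset.prod_congr rfl fun w _ => norm_algebraNorm_completion_pow_mult v w.1 _

/-- **THE MODULE OF A NORM: `‖N_{L/K} 𝐀‖_K = ‖𝐀‖_L`** for every idèle `𝐀 ∈ J_L` — the tree's idèle module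
`IdeleClassGroup.ideleNorm` (normalised absolute values) is compatible with the packet's idèle norm `ideleRelNorm K L`
(`…AdeleNormTrace`).  Weil: the module of `x ↦ ax` on `𝒜_A` is `|N_{𝒜/k}(a)|_A` (here `𝒜 = L`, whose adèle ring is `L_A`
and on which the module of `x ↦ 𝐀x` is `|𝐀|_{L_A}`); Cassels: §11 Theorem `∏_{w∣v} ‖α‖_w = |Norm α|_v` place by place,
with (19.19).  Proof: archimedean part `prod_norm_ideleRelNorm_fst_pow_mult`, finite part `finprod_norm_finiteIdeleRelNorm`.
[cite: WeilBNT1967, Ch. IV §3, Corollary of Proposition 3] [cite: CasselsFrohlichANT1967, Ch. II §11 Theorem, §19 (19.19)] -/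
theorem ideleNorm_ideleRelNorm (y : ideleGroup L) :
    Literature.NumberTheory.Automorphic.IdeleClassGroup.ideleNorm K (ideleRelNorm K L y) =
      Literature.NumberTheory.Automorphic.IdeleClassGroup.ideleNorm L y := by
  apply NNReal.coe_injective
  rw [coe_ideleNorm, coe_ideleNorm, GaloisRepresentations.ideleNorm, GaloisRepresentations.ideleNorm,
    prod_norm_ideleRelNorm_fst_pow_mult, coe_ideleRelNorm_snd, finprod_norm_finiteIdeleRelNorm, IdeleAction.coe_finitePart]

/-- `‖·‖_K ∘ N_{L/K} = ‖·‖_L` as homomorphisms `J_L → ℝ≥0`. [cite: WeilBNT1967, Ch. IV §3, Corollary of Proposition 3] -/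
theorem ideleNorm_comp_ideleRelNorm :
    (Literature.NumberTheory.Automorphic.IdeleClassGroup.ideleNorm K).comp (ideleRelNorm K L).toMonoidHom =
      Literature.NumberTheory.Automorphic.IdeleClassGroup.ideleNorm L :=
  MonoidHom.ext (ideleNorm_ideleRelNorm K L)

/-- Real-valued form (the tree's `GaloisRepresentations.ideleNorm`, `coe_ideleNorm`): `|N 𝐀|_K = |𝐀|_L` in `ℝ`.
[cite: WeilBNT1967, Ch. IV §3, Corollary of Proposition 3] -/
theorem galoisRepresentations_ideleNorm_ideleRelNorm (y : ideleGroup L) :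
    GaloisRepresentations.ideleNorm (ideleRelNorm K L y) = GaloisRepresentations.ideleNorm y := by
  rw [← coe_ideleNorm, ← coe_ideleNorm, ideleNorm_ideleRelNorm]

/-- **`N_{L/K}` maps `J_L¹` to `J_K¹` and detects it: `N 𝐀 ∈ J_K¹ ↔ 𝐀 ∈ J_L¹`** (norm-one idèles, the tree's `normOneIdeles`).
[cite: WeilBNT1967, Ch. IV §3, Corollary of Proposition 3, with §4 (k_A^1)] -/
theorem ideleRelNorm_mem_normOneIdeles_iff (y : ideleGroup L) :
    ideleRelNorm K L y ∈ normOneIdeles K ↔ y ∈ normOneIdeles L := by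
  rw [mem_normOneIdeles, mem_normOneIdeles, ideleNorm_ideleRelNorm]

/-- `N_{L/K}(J_L¹) ≤ J_K¹`. [cite: WeilBNT1967, Ch. IV §3, Corollary of Proposition 3, with §4] -/
theorem map_normOneIdeles_ideleRelNorm_le :
    (normOneIdeles L).map (ideleRelNorm K L).toMonoidHom ≤ normOneIdeles K := by
  rintro _ ⟨y, hy, rfl⟩
  exact (ideleRelNorm_mem_normOneIdeles_iff K L y).2 hy

/-- **On idèle classes: `‖N_{L/K} c‖_K = ‖c‖_L`** for the class-group norms (the tree's `IdeleClassGroup.norm`, the packet's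
`ideleClassRelNorm`). [cite: WeilBNT1967, Ch. IV §3, Corollary of Proposition 3, with §4] [cite: CasselsFrohlichANT1967, Ch. VII §2] -/
theorem norm_ideleClassRelNorm (c : Literature.NumberTheory.Automorphic.IdeleClassGroup L) :
    Literature.NumberTheory.Automorphic.IdeleClassGroup.norm K (ideleClassRelNorm K L c) =
      Literature.NumberTheory.Automorphic.IdeleClassGroup.norm L c := by
  induction c using QuotientGroup.induction_on with
  | H y => rw [ideleClassRelNorm_mk, Literature.NumberTheory.Automorphic.IdeleClassGroup.norm_mk,
      Literature.NumberTheory.Automorphic.IdeleClassGroup.norm_mk, ideleNorm_ideleRelNorm]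

/-- **For `L/K` Galois, the Galois-descent norm has the same module: `‖N y‖_K = ‖y‖_L`** for the tree's
`Automorphic.AdeleRing.ideleRelNorm` (`…AdeleGaloisDescent`; equal to `ideleRelNorm` by `automorphic_ideleRelNorm_eq`).
[cite: WeilBNT1967, Ch. IV §3, Corollary of Proposition 3] [cite: CasselsFrohlichANT1967, Ch. VII §7.3 (a)] -/
theorem ideleNorm_automorphic_ideleRelNorm [IsGalois K L] (y : ideleGroup L) :
    Literature.NumberTheory.Automorphic.IdeleClassGroup.ideleNorm K
        (Literature.NumberTheory.Automorphic.AdeleRing.ideleRelNorm K L y) =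
      Literature.NumberTheory.Automorphic.IdeleClassGroup.ideleNorm L y := by
  rw [automorphic_ideleRelNorm_eq, ideleNorm_ideleRelNorm]

end Module

/-! ## §4 `‖con_{L/K} 𝐚‖_L = ‖𝐚‖_K^{[L:K]}` -/

section Conorm

open NumberField.InfinitePlace
open Literature.NumberTheory.Automorphic (coe_ideleNorm mem_normOneIdeles normOneIdeles)

variable (K L : Type) [Field K] [NumberField K] [Field L] [NumberField L] [Algebra K L]

/-- The archimedean components of `con 𝐚` have the absolute values of those of `𝐚`: `‖(con 𝐚)_w‖ = ‖a_{w|K}‖`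
(`K_v → L_w` is an isometry, the tree's `norm_infiniteCompletionOfComap`). [cite: CasselsFrohlichANT1967, Ch. II §10, §19 (19.2)] -/
theorem norm_coe_ideleBaseChange_fst_apply (x : ideleGroup K) (w : InfinitePlace L) :
    ‖((Literature.NumberTheory.Automorphic.AdeleRing.ideleBaseChange K L x : ideleGroup L) : AdeleRing (𝓞 L) L).1 w‖ =
      ‖(x : AdeleRing (𝓞 K) K).1 (w.comap (algebraMap K L))‖ := by
  rw [Literature.NumberTheory.Automorphic.AdeleRing.coe_ideleBaseChange,
    Literature.NumberTheory.Automorphic.AdeleRing.baseChange_fst,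
    Literature.NumberTheory.Automorphic.InfiniteAdeleRing.baseChange_apply,
    Literature.NumberTheory.Automorphic.norm_infiniteCompletionOfComap]

/-- **The archimedean part: `∏_w ‖(con 𝐚)_w‖^{mult w} = (∏_v ‖a_v‖^{mult v})^{[L:K]}`** (regroup along `w ↦ w|_K` and
use `∑_{w∣v} mult w = mult v · [L:K]`). [cite: CasselsFrohlichANT1967, Ch. II §11 («‖b‖ = |b|^N»), §19 (19.14)] -/
theorem prod_norm_ideleBaseChange_fst_pow_mult (x : ideleGroup K) :
    ∏ w : InfinitePlace L,
        ‖((Literature.NumberTheory.Automorphic.AdeleRing.ideleBaseChange K L x : ideleGroup L) : AdeleRing (𝓞 L) L).1 w‖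
          ^ w.mult =
      (∏ v : InfinitePlace K, ‖(x : AdeleRing (𝓞 K) K).1 v‖ ^ v.mult) ^ finrank K L := by
  classical
  simp_rw [norm_coe_ideleBaseChange_fst_apply]
  rw [← Fintype.prod_fiberwise (fun w : InfinitePlace L => w.comap (algebraMap K L))
    (fun w : InfinitePlace L => ‖(x : AdeleRing (𝓞 K) K).1 (w.comap (algebraMap K L))‖ ^ w.mult), ← Finset.prod_pow]
  refine Finset.prod_congr rfl fun v _ => ?_
  have key : ∀ w : v.Extension L,
      ‖(x : AdeleRing (𝓞 K) K).1 (w.1.comap (algebraMap K L))‖ ^ w.1.mult = ‖(x : AdeleRing (𝓞 K) K).1 v‖ ^ w.1.mult := by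
    rintro ⟨w, rfl⟩; rfl
  rw [Finset.prod_congr rfl fun w _ => key w, Finset.prod_pow_eq_pow_sum, sum_mult_extension L v, pow_mul]

/-- **THE MODULE OF A CONORM: `‖con_{L/K} 𝐚‖_L = ‖𝐚‖_K^{[L:K]}`** for every idèle `𝐚 ∈ J_K`, `con` the tree's
`Automorphic.AdeleRing.ideleBaseChange K L` (= the packet's `NumberField.AdeleRing.baseChange` on units, `…AutomorphicCompat`).
Weil's Corollary with `a = 𝐚 ∈ k_A ⊂ k'_A`, `N_{k'/k}(𝐚) = 𝐚^n`; Cassels's «‖b‖ = |b|^N» place by place.  Proof: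
`prod_norm_ideleBaseChange_fst_pow_mult` and `finprod_norm_finiteIdeleConorm`.
[cite: WeilBNT1967, Ch. IV §3, Corollary of Proposition 3] [cite: CasselsFrohlichANT1967, Ch. II §11 Lemma (proof, «‖b‖ = |b|^N»), §19 (19.11)] -/
theorem ideleNorm_ideleBaseChange (x : ideleGroup K) :
    Literature.NumberTheory.Automorphic.IdeleClassGroup.ideleNorm L
        (Literature.NumberTheory.Automorphic.AdeleRing.ideleBaseChange K L x) =
      Literature.NumberTheory.Automorphic.IdeleClassGroup.ideleNorm K x ^ finrank K L := by
  apply NNReal.coe_injective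
  rw [NNReal.coe_pow, coe_ideleNorm, coe_ideleNorm, GaloisRepresentations.ideleNorm, GaloisRepresentations.ideleNorm,
    prod_norm_ideleBaseChange_fst_pow_mult, coe_ideleBaseChange_snd, finprod_norm_finiteIdeleConorm,
    IdeleAction.coe_finitePart, mul_pow]

/-- `‖·‖_L ∘ con_{L/K} = ‖·‖_K^n` as homomorphisms `J_K → ℝ≥0`. [cite: WeilBNT1967, Ch. IV §3, Corollary of Proposition 3] -/
theorem ideleNorm_comp_ideleBaseChange :
    (Literature.NumberTheory.Automorphic.IdeleClassGroup.ideleNorm L).comp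
        (Literature.NumberTheory.Automorphic.AdeleRing.ideleBaseChange K L) =
      (powMonoidHom (finrank K L)).comp (Literature.NumberTheory.Automorphic.IdeleClassGroup.ideleNorm K) :=
  MonoidHom.ext (ideleNorm_ideleBaseChange K L)

/-- The same for the packet's map `Units.map (NumberField.AdeleRing.baseChange K L)` (FLT's adelic base change on units).
[cite: WeilBNT1967, Ch. IV §3, Corollary of Proposition 3] [cite: CasselsFrohlichANT1967, Ch. II §19 (19.11)] -/
theorem ideleNorm_units_map_baseChange (x : ideleGroup K) :
    Literature.NumberTheory.Automorphic.IdeleClassGroup.ideleNorm L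
        (Units.map (NumberField.AdeleRing.baseChange K L : AdeleRing (𝓞 K) K →* AdeleRing (𝓞 L) L) x) =
      Literature.NumberTheory.Automorphic.IdeleClassGroup.ideleNorm K x ^ finrank K L := by
  have h : Units.map (NumberField.AdeleRing.baseChange K L : AdeleRing (𝓞 K) K →* AdeleRing (𝓞 L) L) x =
      Literature.NumberTheory.Automorphic.AdeleRing.ideleBaseChange K L x :=
    Units.ext (adeleRing_baseChange_apply_eq K L (x : AdeleRing (𝓞 K) K))
  rw [h, ideleNorm_ideleBaseChange]

/-- Real-valued form: `|con 𝐚|_L = |𝐚|_K^n` for the tree's `GaloisRepresentations.ideleNorm`.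
[cite: WeilBNT1967, Ch. IV §3, Corollary of Proposition 3] -/
theorem galoisRepresentations_ideleNorm_ideleBaseChange (x : ideleGroup K) :
    GaloisRepresentations.ideleNorm (Literature.NumberTheory.Automorphic.AdeleRing.ideleBaseChange K L x) =
      GaloisRepresentations.ideleNorm x ^ finrank K L := by
  rw [← coe_ideleNorm, ← coe_ideleNorm, ideleNorm_ideleBaseChange, NNReal.coe_pow]

/-- **`con 𝐚 ∈ J_L¹ ↔ 𝐚 ∈ J_K¹`** (`‖con 𝐚‖ = ‖𝐚‖^n` with `n ≥ 1`). [cite: WeilBNT1967, Ch. IV §3, Corollary of Proposition 3, with §4] -/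
theorem ideleBaseChange_mem_normOneIdeles_iff (x : ideleGroup K) :
    Literature.NumberTheory.Automorphic.AdeleRing.ideleBaseChange K L x ∈ normOneIdeles L ↔ x ∈ normOneIdeles K := by
  rw [mem_normOneIdeles, mem_normOneIdeles, ideleNorm_ideleBaseChange]
  exact pow_eq_one_iff_of_nonneg bot_le (Module.finrank_pos (R := K) (M := L)).ne'

/-- **`‖N_{L/K}(con_{L/K} 𝐚)‖_K = ‖𝐚‖_K^n`** — consistent with (19.11) `N(con 𝐚) = 𝐚^n`.
[cite: CasselsFrohlichANT1967, Ch. II §19 (19.11)] -/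
theorem ideleNorm_ideleRelNorm_ideleBaseChange (x : ideleGroup K) :
    Literature.NumberTheory.Automorphic.IdeleClassGroup.ideleNorm K
        (ideleRelNorm K L (Literature.NumberTheory.Automorphic.AdeleRing.ideleBaseChange K L x)) =
      Literature.NumberTheory.Automorphic.IdeleClassGroup.ideleNorm K x ^ finrank K L := by
  rw [ideleNorm_ideleRelNorm, ideleNorm_ideleBaseChange]

end Conorm

end Literature.NumberTheory.AdelicBaseChange

end
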